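import Mathlib
import Summits.Ventures.FusionMHD.Models.CerfonFreidbergIterLikeQ90Defs
import HarnessLib

/-!
# Ventures/FusionMHD — Models/CerfonFreidbergIterLikeQ90Panels10.lean: KERNEL CHECK of panels 21, 22 (of 32) of the
# certified safety factor `q(ψ_N = 9/10)/F` of THE Cerfon–Freidberg ITER-like instance (sibling of `…IterLikeQHalfPanels*.lean`)

HONEST FRAMING (LADDER-GRIDFUSION three columns; CF rung, F2 item R2, q-profile sample).  One `decide +kernel` (≈ 73 s on the farm): for
each panel `j` listed, the per-panel obligation `CFIterLike.Q90.PanelCert.ok` (`Models/CerfonFreidbergIterLikeQ90Defs.lean`) — the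
Taylor-model run of `CFIterLike.Q90.progG` over the ITER-like parameter box is ACCEPTED (every `log`/`sin`/`cos` composition and the `inv`
certificate), and the kernel's panel-integral enclosure of the polar `(6.35)` integrand along the approximant, the range of the flux residual
`U(ray m) − U_a/10`, the range of the approximant `m` and the range of the radial derivative `D_r(θ, m)` lie inside the integers claimed in
`panelCert10` (values read off a compiled `#eval` of the same functions, slack one unit of `2⁻⁶⁰`; probe `QProbeIF*.lean`, generator
`pub/gridfusion/models/gen-model-5/g8/gen90/mkdefsN.py`).  What these Booleans MEAN (real-number statements, uniformly over the parameter box ∋ THE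
ITER-like instance) is proved once in `Models/CerfonFreidbergIterLikeQ90Sound.lean`.  MODELLED: analytic Cerfon–Freidberg family; `q` of a
MODEL surface — nothing about a device or stability.  No `native_decide`.  Typer/prover: gridfusion-model-5 (g8), 2026-08-27.
Citations: Freidberg 2014 §6.3.5 (6.35) [Freidberg2014]; Mahboubi–Melquiond–Sibut-Pinote 2016 §3.2 Lemma 3 [MahboubiMelquiondSibutpinote2016].
-/

namespace Summit.Ventures.FusionMHD.Models.CFIterLike.Q90

/-- The certificate data of panels 21, 22 (`ψ_N = 9/10`): `inv` candidate (degree-12 fit of `(X·D_r)⁻¹` in the panel variable, scaled by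
`2⁶⁰`), Taylor degree, `inv` widening `2^elog2`, and the claimed integral / residual / `m`-range / `D_r`-range integers (× `2⁶⁰`). [instance data] -/
def panelCert10 : List PanelCert := [
  { j := 21, cand := [15791785697511297024, -7389230872504461312, -413213804476588883968, 2694313636898116993024, 6588489037747844022272, -185316635401722628407296, 726740246202960733798400, 6424739628182746905444352, -82292708710916565623635968, 117316148758829005795229696, 4291371920747719082157015040, -32009996688180253250467921920, -66085322276122090678425485312],
    deg := 12, elog2 := 36, plo := 781801323066024920, phi := 781801330709574397, eta := 81980399, mlo := 567909961411027670, mhi := 597910212551789042,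
    dlo := 103688840283606633, dhi := 110622509198357818 },
  { j := 22, cand := [15241122654166636544, -25246464158566432768, -166053490847243829248, 2248075548030943625216, -9383647819399112425472, -25289468000245569814528, 615492152305809381916672, -3660161148879817605644288, 161627966463372284657664, 172654462905490916893523968, -1387131331157037191415201792, 2348100561395215067485569024, 40780799662892435451137753088],
    deg := 10, elog2 := 36, plo := 716556784686988309, phi := 716556791923477908, eta := 74020406, mlo := 536318531366381123, mhi := 568734173162831163,
    dlo := 109838738892061312, dhi := 119682952891947566 }]

/-- **KERNEL CHECK** of panels 21, 22 of the ITER-like surface `ψ_N = 9/10`. -/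
theorem panelCert10_ok : CFIterLike.Q90.panelCert10.all PanelCert.ok = true := by
  decide +kernel

end Summit.Ventures.FusionMHD.Models.CFIterLike.Q90
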